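import Summits.CriticalPhenomena.PercolationContinuityZ3.Theorems.Transplant.HalfSpaceUniquenessGeometry
import Summits.CriticalPhenomena.PercolationContinuityZ3.Theorems.Transplant.PlanarConePeierls
import Literature.Probability.Percolation.ExteriorConnectionEvents
import HarnessLib

/-!
# Reach events: finite-window approximations of the arms, straight walks, constrained reachability

builds on p205010 (kernel theorem, internal audit signed; external expert review pending) — nothing in this file uses p205010.
Lane `prim-bschramm`, seat `prim-bschramm-p2` gen 16 (class C1b); helper file (`--supports stmt-CriticalPhenomena-4575 --as helper`)
for the half-space uniqueness programme (TARGET 3g).  Continues `HalfSpaceUniquenessGeometry`.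

The sprinkling inequality of the tree (`sprinkling_le_of_lt`, Aizenman–Chayes–Chayes–Fröhlich–Russo 1983 Lemma 4.2 (a) in the
reserve-coin currency) needs events determined by FINITELY many edges, whereas an arm "`a ↔ ∞` inside a thick cone" is not.  The
finite-window substitute is the REACH EVENT `reachEvent K a T = {∃ z ∈ T, a ↔ z via K}` for a finite step graph `K`:

* §1 `reachEvent`: increasing, measurable, determined by `E(K)`;
* §2 **`percolatesVia_subset_reachEvent_le` / `_ge`**: if the region `S ∩ {x_j ≤ M}` is finite, an infinite `S`-constrained cluster at
  `a` (`a_j ≤ M`) reaches the level `{x_j = M}` through steps inside `S ∩ {x_j ≤ M}` (first passage), so that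
  `P(reachEvent) ≥ P(a ↔ ∞ in S)`;
* §3 straight lattice walks (`exists_straight_walk`) and reachability of the vertices of a walk (`reachable_of_mem_support'`).
[cite: AizenmanChayesChayesFrohlichRusso1983, §4 Lemma 4.2 (a), Lemma 4.3] -/

noncomputable section

namespace Summit.CriticalPhenomena.PercolationContinuityZ3.Theorems.Transplant

namespace HSU

open MeasureTheory Literature.Probability.Percolation Literature.Probability.LatticeModels SimpleGraph
open scoped Classical

variable {d : ℕ}

/-! ## §1 Reach events -/

/-- The reach event `{∃ z ∈ T, a ↔ z via K}`: the `K`-constrained open cluster of `a` meets the target set `T`.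
[cite: AizenmanChayesChayesFrohlichRusso1983, §4 (4.27) ("connected to ∂Λ_N … within Λ_N")] -/
def reachEvent (K : SimpleGraph (Site d)) (a : Site d) (T : Set (Site d)) : Set (BondConfig (Site d)) :=
  {ω | ∃ z ∈ T, ω ∈ openConnVia K a z}

/-- The reach event is the preimage, under restriction to `E(K)`, of `{∃ z ∈ T, a ↔ z}`. [folklore] -/
theorem reachEvent_eq_preimage (K : SimpleGraph (Site d)) (a : Site d) (T : Set (Site d)) :
    reachEvent K a T = (fun ω : BondConfig (Site d) => ω ∩ K.edgeSet) ⁻¹' {η | ∃ z ∈ T, η ∈ openConn a z} := rfl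

/-- Reach events are increasing. [folklore] -/
theorem isUpperSet_reachEvent (K : SimpleGraph (Site d)) (a : Site d) (T : Set (Site d)) : IsUpperSet (reachEvent K a T) := by
  intro ω ω' hle ⟨z, hz, hω⟩
  exact ⟨z, hz, isUpperSet_openConnVia K a z hle hω⟩

/-- Reach events are measurable. [folklore] -/
theorem measurableSet_reachEvent (K : SimpleGraph (Site d)) (a : Site d) (T : Set (Site d)) : MeasurableSet (reachEvent K a T) := by
  have : reachEvent K a T = ⋃ z ∈ T, openConnVia K a z := by
    ext ω; simp only [reachEvent, Set.mem_setOf_eq, Set.mem_iUnion, exists_prop]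
  rw [this]
  exact MeasurableSet.biUnion (Set.to_countable T) fun z _ => measurableSet_openConnVia K a z

/-- Reach events are determined by the edges of the step graph. [folklore] -/
theorem determinedBy_reachEvent (K : SimpleGraph (Site d)) (a : Site d) (T : Set (Site d)) :
    DeterminedBy (reachEvent K a T) K.edgeSet := by
  rw [reachEvent_eq_preimage]; exact determinedBy_preimage_inter _ _

/-- The edge set of `withinGraph ℤ^d S` lies in the edges of `ℤ^d` inside any finset containing `S`. [folklore] -/
theorem edgeSet_withinGraph_subset_edgesIn {S : Set (Site d)} {B : Finset (Site d)} (hSB : S ⊆ ↑B) :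
    (withinGraph (zdGraph d) S).edgeSet ⊆ ↑(edgesIn (zdGraph d) B) := by
  intro e he
  induction e using Sym2.ind with
  | h x y =>
    rw [mem_edgeSet_withinGraph] at he
    rw [Finset.mem_coe, mem_edgesIn_iff]
    refine ⟨(SimpleGraph.mem_edgeSet _).2 he.1, fun v hv => ?_⟩
    rcases Sym2.mem_iff.1 hv with rfl | rfl
    · exact hSB he.2.1
    · exact hSB he.2.2

/-! ## §2 An infinite constrained cluster reaches every level: first passage -/

/-- **Upward first passage.** If `a ∈ S`, `a_j ≤ M` and `S ∩ {x_j ≤ M}` is finite, an infinite open cluster of `a` with steps inside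
`S` reaches the level `{x_j = M}` by steps inside `S ∩ {x_j ≤ M}`.
[cite: AizenmanChayesChayesFrohlichRusso1983, §4 proof of Thm 4.4 (connected to ∂Λ_N within Λ_N)] -/
theorem percolatesVia_subset_reachEvent_le {S : Set (Site d)} {a : Site d} (ha : a ∈ S) (j : Fin d) {M : ℤ} (haM : a j ≤ M)
    (hfin : (S ∩ {x | x j ≤ M}).Finite) :
    percolatesVia (withinGraph (zdGraph d) S) a ⊆
      reachEvent (withinGraph (zdGraph d) (S ∩ {x | x j ≤ M})) a {z | z j = M} := by
  intro ω hω
  -- a vertex of the (infinite) constrained cluster above level `M`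
  obtain ⟨y, hy, hyS'⟩ : ∃ y ∈ openClusterIn (withinGraph (zdGraph d) S) ω a, y ∉ S ∩ {x | x j ≤ M} := by
    by_contra h
    push Not at h
    exact hω (hfin.subset h)
  have hyS : y ∈ S := openClusterIn_withinGraph_subset ha ω hy
  have hyM : M ≤ y j := by
    by_contra h'; exact hyS' ⟨hyS, by simp only [Set.mem_setOf_eq]; omega⟩
  obtain ⟨Wk⟩ := mem_openClusterIn_iff.1 hy
  obtain ⟨e, W, he, hW⟩ := exists_prefix_apply_eq (openGraph_inf_withinGraph_le ω S) j Wk haM hyM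
  have hsuppS : ∀ z ∈ Wk.support, z ∈ S := support_subset_of_walk_within Wk ha
  refine ⟨e, he, mem_openConnVia_iff.2 (reachable_within_of_support_subset W fun z hz => ?_)⟩
  exact ⟨hsuppS z (hW z hz).1, (hW z hz).2⟩

/-- **Downward first passage** (the same for the level `{x_j = M}` approached from above). [folklore] -/
theorem percolatesVia_subset_reachEvent_ge {S : Set (Site d)} {a : Site d} (ha : a ∈ S) (j : Fin d) {M : ℤ} (haM : M ≤ a j)
    (hfin : (S ∩ {x | M ≤ x j}).Finite) :
    percolatesVia (withinGraph (zdGraph d) S) a ⊆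
      reachEvent (withinGraph (zdGraph d) (S ∩ {x | M ≤ x j})) a {z | z j = M} := by
  intro ω hω
  obtain ⟨y, hy, hyS'⟩ : ∃ y ∈ openClusterIn (withinGraph (zdGraph d) S) ω a, y ∉ S ∩ {x | M ≤ x j} := by
    by_contra h
    push Not at h
    exact hω (hfin.subset h)
  have hyS : y ∈ S := openClusterIn_withinGraph_subset ha ω hy
  have hyM : y j ≤ M := by
    by_contra h'; exact hyS' ⟨hyS, by simp only [Set.mem_setOf_eq]; omega⟩
  obtain ⟨Wk⟩ := mem_openClusterIn_iff.1 hy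
  obtain ⟨e, W, he, hW⟩ := exists_prefix_neg_apply_eq (openGraph_inf_withinGraph_le ω S) j Wk haM hyM
  have hsuppS : ∀ z ∈ Wk.support, z ∈ S := support_subset_of_walk_within Wk ha
  refine ⟨e, he, mem_openConnVia_iff.2 (reachable_within_of_support_subset W fun z hz => ?_)⟩
  exact ⟨hsuppS z (hW z hz).1, (hW z hz).2⟩

/-- **Probability of a reach event from an arm bound**: if `α ≤ P(a ↔ ∞ in S)` then `α ≤ P(reach)` for every reach event containing
the arm event. [folklore] -/
theorem le_real_of_subset {p : unitInterval} {A B : Set (BondConfig (Site d))} (hAB : A ⊆ B) {α : ℝ}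
    (hα : α ≤ (bondPercolation (zdGraph d) p).real A) : α ≤ (bondPercolation (zdGraph d) p).real B :=
  hα.trans (measureReal_mono hAB)

/-! ## §3 Straight walks; reachability of the vertices of a walk -/

/-- **Straight lattice walk** `x, x + εe_j, …, x + n εe_j` (`ε = ±1`), all of whose vertices are of the form `x + m εe_j`, `m ≤ n`.
[folklore] -/
theorem exists_straight_walk (x : Site d) (j : Fin d) {ε : ℤ} (hε : ε = 1 ∨ ε = -1) (n : ℕ) :
    ∃ W : (zdGraph d).Walk x (x + (n : ℤ) • Pi.single j ε),
      ∀ z ∈ W.support, ∃ m : ℕ, m ≤ n ∧ z = x + (m : ℤ) • Pi.single j ε := by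
  induction n generalizing x with
  | zero =>
    refine ⟨(Walk.nil : (zdGraph d).Walk x x).copy rfl (by simp), fun z hz => ⟨0, le_rfl, ?_⟩⟩
    rw [Walk.support_copy, Walk.support_nil, List.mem_singleton] at hz
    simp [hz]
  | succ n ih =>
    obtain ⟨W, hW⟩ := ih (x + Pi.single j ε)
    have hadj : (zdGraph d).Adj x (x + Pi.single j ε) := by
      have := PlanarCone.zdGraph_adj_add_sunit x j hε
      simpa [PlanarCone.sunit] using this
    have heq : x + Pi.single j ε + (n : ℤ) • Pi.single j ε = x + ((n + 1 : ℕ) : ℤ) • Pi.single j ε := by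
      rw [add_assoc, Nat.cast_succ, add_smul, one_smul, add_comm (Pi.single j ε : Site d)]
    refine ⟨(Walk.cons hadj W).copy rfl heq, fun z hz => ?_⟩
    rw [Walk.support_copy, Walk.support_cons, List.mem_cons] at hz
    rcases hz with rfl | hz
    · exact ⟨0, Nat.zero_le _, by simp⟩
    · obtain ⟨m, hm, rfl⟩ := hW z hz
      refine ⟨m + 1, by omega, ?_⟩
      rw [add_assoc, Nat.cast_succ, add_smul, one_smul, add_comm (Pi.single j ε : Site d)]

/-- Every vertex of a walk is reachable from its start. [folklore] -/
theorem reachable_of_mem_support' {V : Type*} {G : SimpleGraph V} {a b : V} (W : G.Walk a b) :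
    ∀ z ∈ W.support, G.Reachable a z := by
  induction W with
  | nil => intro z hz; rw [Walk.support_nil, List.mem_singleton] at hz; rw [hz]
  | @cons u v w h p ih =>
    intro z hz
    rw [Walk.support_cons, List.mem_cons] at hz
    rcases hz with rfl | hz
    · rfl
    · exact h.reachable.trans (ih z hz)

/-- **Monotonicity of constrained connections in both arguments**: `openGraph ω ⊓ K ≤ openGraph ω' ⊓ K'` when `ω ⊆ ω'`, `K ≤ K'`.
[folklore] -/
theorem reachable_inf_mono {ω ω' : BondConfig (Site d)} (hω : ω ⊆ ω') {K K' : SimpleGraph (Site d)} (hK : K ≤ K')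
    {x y : Site d} (h : (openGraph ω ⊓ K).Reachable x y) : (openGraph ω' ⊓ K').Reachable x y :=
  h.mono (inf_le_inf (openGraph_mono hω) hK)

end HSU

end Summit.CriticalPhenomena.PercolationContinuityZ3.Theorems.Transplant

end
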